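import Summits.Ventures.HodgeRepro2.T5BergmanIntegrableCoeffThree
import Summits.Ventures.HodgeRepro2.T5BergmanSchurGeneralU11

/-!
# Integrability of ALL `K`-finite matrix coefficients (`k ≥ 3`), on `SU(1,1)` and on `U(1,1)`

`T5BergmanIntegrableCoeffThree` gives the integrability of the monomial coefficients
`⟨π_k(g) zᵐ, zⁿ⟩_k` for `k ≥ 3`. By sesquilinearity every matrix coefficient of two POLYNOMIALS
(`K`-finite vectors) is a finite combination of them (`matrixCoeff_partialSum_partialSum`), hence
decays like `|a(g)|^{-k}` (`norm_matrixCoeff_partialSum_partialSum_le`) and is integrable against every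
Haar measure of `SU(1,1)` (`integrable_matrixCoeff_partialSum_partialSum`). On `H_j = U(1,1)` the modulus
of a coefficient is invariant under the centre, so `|⟨π_k(g) zᵐ, zⁿ⟩_k|` is integrable against every
Haar measure of `U(1,1)` as well (`integrable_norm_matrixCoeffU_monomial_monomial`), through the
quotient map `mulHom` of `T5BergmanSchurGeneralU11`.

Blind lane: Mathlib + the HodgeRepro2 prefix only; no sorry; axioms ⊆ {propext, Classical.choice,
Quot.sound}.
-/

namespace Summit.Ventures.HodgeRepro2.T5BergmanIntegrableKFinite

open MeasureTheory MeasureTheory.Measure Metric Filter Topology Finset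
open T5PoincareMeasure T5SU11Unimodular T5U11Unimodular T5U11Product T5SU11Fibration
  T5SU11FibrationHaar T5HaarCircle T5SU11CoefficientL2 T5U11CoefficientL2
open T5BergmanCoefficient T5BergmanPairing T5BergmanUnitary T5BergmanFourier T5BergmanParseval
  T5BergmanProjection T5BergmanCoefficientL2 T5BergmanActStable T5BergmanMatrixCoeff
  T5BergmanSchurGeneral T5BergmanKTypeMatrix T5BergmanIntegrableCoeff T5BergmanIntegrableCoeffThree
  T5BergmanSchurGeneralU11
open scoped Real

/-! ### Sesquilinearity in both slots on polynomials -/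

/-- Right linearity on a polynomial: `⟨π_k(g) f, Σ_{n<M} bₙ zⁿ⟩_k = Σ_{n<M} conj(bₙ) ⟨π_k(g) f, zⁿ⟩_k`. -/
theorem matrixCoeff_partialSum_right (k : ℕ) (hk : 2 ≤ k) (f : ℂ → ℂ)
    (hf : DifferentiableOn ℂ f (ball 0 1))
    (hfint : IntegrableOn (fun w => ‖f w‖ ^ 2 * (1 - ‖w‖ ^ 2) ^ (k - 2)) (ball (0 : ℂ) 1))
    (b : ℕ → ℂ) (M : ℕ) (g : SU11) :
    matrixCoeff k f (partialSum b M) g =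
      ∑ n ∈ range M, (starRingEnd ℂ) (b n) * matrixCoeff k f (fun w => w ^ n) g := by
  have hF : DifferentiableOn ℂ (act k g f) (ball 0 1) := differentiableOn_act k g f hf
  have hFint := integrableOn_act k hk g f hf hfint
  -- `⟨F, S⟩ = conj ⟨S, F⟩ = conj (Σ bₙ ⟨zⁿ, F⟩) = Σ conj bₙ ⟨F, zⁿ⟩`
  have e1 : pairing k (partialSum b M) (act k g f) =
      ∑ n ∈ range M, b n * pairing k (fun w => w ^ n) (act k g f) := by
    have h := matrixCoeff_partialSum k hk b M (act k g f) hF.continuousOn hFint 1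
    unfold matrixCoeff at h
    rw [pairing_congr (fun z _ => act_one k _ z) (fun _ _ => rfl)] at h
    rw [h]
    refine Finset.sum_congr rfl fun n _ => ?_
    rw [pairing_congr (fun z _ => act_one k _ z) (fun _ _ => rfl)]
  unfold matrixCoeff
  rw [pairing_conj_symm k (partialSum b M) (act k g f), e1, _root_.map_sum]
  refine Finset.sum_congr rfl fun n _ => ?_
  rw [map_mul, pairing_conj_symm k (fun w => w ^ n) (act k g f)]

/-- **The coefficient of two polynomials**:
`⟨π_k(g) S_N, T_M⟩_k = Σ_{m<N} Σ_{n<M} aₘ conj(bₙ) ⟨π_k(g) zᵐ, zⁿ⟩_k`. -/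
theorem matrixCoeff_partialSum_partialSum (k : ℕ) (hk : 2 ≤ k) (a b : ℕ → ℂ) (N M : ℕ) (g : SU11) :
    matrixCoeff k (partialSum a N) (partialSum b M) g =
      ∑ m ∈ range N, ∑ n ∈ range M,
        a m * (starRingEnd ℂ) (b n) * matrixCoeff k (fun w => w ^ m) (fun w => w ^ n) g := by
  rw [matrixCoeff_partialSum k hk a N _ (differentiable_partialSum b M).continuous.continuousOn
    (integrableOn_partialSum k b M) g]
  refine Finset.sum_congr rfl fun m _ => ?_
  rw [matrixCoeff_partialSum_right k hk _ (differentiableOn_monomial m) (integrableOn_monomial k m) b M g,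
    Finset.mul_sum]
  refine Finset.sum_congr rfl fun n _ => ?_
  ring

/-- The decay constant of a pair of polynomials. -/
noncomputable def polyDecayConst (k : ℕ) (a b : ℕ → ℂ) (N M : ℕ) : ℝ :=
  ∑ m ∈ range N, ∑ n ∈ range M, ‖a m‖ * ‖b n‖ * (decayConst k m n * monomialNormSq k n)

/-- **Decay for `K`-finite vectors**: `|⟨π_k(g) S_N, T_M⟩_k| ≤ C(S_N, T_M) · |a(g)|^{-k}`. -/
theorem norm_matrixCoeff_partialSum_partialSum_le (k : ℕ) (hk : 2 ≤ k) (a b : ℕ → ℂ) (N M : ℕ)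
    (g : SU11) :
    ‖matrixCoeff k (partialSum a N) (partialSum b M) g‖ ≤
      polyDecayConst k a b N M * ‖mat g 0 0‖⁻¹ ^ k := by
  rw [matrixCoeff_partialSum_partialSum k hk a b N M g]
  unfold polyDecayConst
  rw [Finset.sum_mul]
  refine (norm_sum_le _ _).trans (Finset.sum_le_sum fun m _ => ?_)
  rw [Finset.sum_mul]
  refine (norm_sum_le _ _).trans (Finset.sum_le_sum fun n _ => ?_)
  rw [norm_mul, norm_mul, Complex.norm_conj]
  calc ‖a m‖ * ‖b n‖ * ‖matrixCoeff k (fun w => w ^ m) (fun w => w ^ n) g‖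
      ≤ ‖a m‖ * ‖b n‖ * (decayConst k m n * monomialNormSq k n * ‖mat g 0 0‖⁻¹ ^ k) := by
        gcongr
        exact norm_matrixCoeff_monomial_monomial_le k hk g m n
    _ = _ := by ring

/-- `|⟨π_k(λ g) zᵐ, zⁿ⟩_k| = |⟨π_k(g) zᵐ, zⁿ⟩_k|` (the central character has modulus one). -/
lemma norm_matrixCoeffU_mulHom' (k : ℕ) (f h : ℂ → ℂ) (lam : Circle) (g : SU11) :
    ‖matrixCoeffU k f h (mulHom (lam, g))‖ = ‖matrixCoeff k f h g‖ := by
  rw [matrixCoeffU_mulHom, norm_mul, norm_pow, Circle.norm_coe, one_pow, one_mul]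

/-- `|matrixCoeffU|` is continuous on `U(1,1)` for holomorphic `f, h ∈ A_k`. -/
lemma continuous_norm_matrixCoeffU (k : ℕ) (hk : 2 ≤ k) (f h : ℂ → ℂ)
    (hf : DifferentiableOn ℂ f (ball 0 1))
    (hfint : IntegrableOn (fun w => ‖f w‖ ^ 2 * (1 - ‖w‖ ^ 2) ^ (k - 2)) (ball (0 : ℂ) 1))
    (hh : DifferentiableOn ℂ h (ball 0 1))
    (hhint : IntegrableOn (fun w => ‖h w‖ ^ 2 * (1 - ‖w‖ ^ 2) ^ (k - 2)) (ball (0 : ℂ) 1)) :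
    Continuous fun g : U11 => ‖matrixCoeffU k f h g‖ := by
  rw [isQuotientMap_mulHom.continuous_iff]
  have e : ((fun g : U11 => ‖matrixCoeffU k f h g‖) ∘ mulHom) =
      fun p : Circle × SU11 => ‖matrixCoeff k f h p.2‖ := by
    ext p
    exact norm_matrixCoeffU_mulHom' k f h p.1 p.2
  rw [e]
  exact ((continuous_matrixCoeff_of_differentiableOn k hk f hf hfint h hh hhint).comp
    continuous_snd).norm

variable [MeasurableSpace Circle] [BorelSpace Circle]

/-- **Every `K`-finite matrix coefficient is integrable for `k ≥ 3`**: `g ↦ ⟨π_k(g) S_N, T_M⟩_k` is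
integrable against every Haar measure of `SU(1,1)` for polynomials `S_N, T_M`. -/
theorem integrable_matrixCoeff_partialSum_partialSum (μ : Measure SU11) [IsHaarMeasure μ] (k : ℕ)
    (hk : 3 ≤ k) (a b : ℕ → ℂ) (N M : ℕ) :
    Integrable (matrixCoeff k (partialSum a N) (partialSum b M)) μ := by
  have hk2 : 2 ≤ k := by omega
  have e : matrixCoeff k (partialSum a N) (partialSum b M) = fun g => ∑ m ∈ range N, ∑ n ∈ range M,
      a m * (starRingEnd ℂ) (b n) * matrixCoeff k (fun w => w ^ m) (fun w => w ^ n) g :=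
    funext fun g => matrixCoeff_partialSum_partialSum k hk2 a b N M g
  rw [e]
  refine integrable_finsetSum _ fun m _ => integrable_finsetSum _ fun n _ => ?_
  exact (integrable_matrixCoeff_monomial_monomial_of_three_le μ k hk m n).const_mul _

/-! ### On `H_j = U(1,1)` -/

variable [MeasurableSpace U11] [BorelSpace U11]

/-- **On `U(1,1)`**: for `k ≥ 3`, `g ↦ |⟨π_k(g) zᵐ, zⁿ⟩_k|` is integrable against every Haar measure of
`U(1,1)`. -/
theorem integrable_norm_matrixCoeffU_monomial_monomial (μU : Measure U11) [IsHaarMeasure μU] (k : ℕ)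
    (hk : 3 ≤ k) (m n : ℕ) :
    Integrable (fun g => ‖matrixCoeffU k (fun w => w ^ m) (fun w => w ^ n) g‖) μU := by
  have hk2 : 2 ≤ k := by omega
  set c := haarScalarFactor (map mulHom (haarCircle.prod (nu haarCircle))) μU with hc
  have hc0 : c ≠ 0 := (T5U11Product.haarScalarFactor_pos haarCircle (nu haarCircle) μU).ne'
  have hmap : map mulHom (haarCircle.prod (nu haarCircle)) = c • μU :=
    map_mulHom_prod_eq_smul haarCircle (nu haarCircle) μU
  have hmeas : AEStronglyMeasurable (fun g => ‖matrixCoeffU k (fun w => w ^ m) (fun w => w ^ n) g‖)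
      (map mulHom (haarCircle.prod (nu haarCircle))) :=
    (continuous_norm_matrixCoeffU k hk2 _ _ (differentiableOn_monomial m) (integrableOn_monomial k m)
      (differentiableOn_monomial n) (integrableOn_monomial k n)).aestronglyMeasurable
  have hint' : Integrable (fun g => ‖matrixCoeffU k (fun w => w ^ m) (fun w => w ^ n) g‖)
      (map mulHom (haarCircle.prod (nu haarCircle))) := by
    rw [integrable_map_measure hmeas continuous_mulHom.measurable.aemeasurable]
    have e : ((fun g => ‖matrixCoeffU k (fun w => w ^ m) (fun w => w ^ n) g‖) ∘ mulHom) =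
        fun q : Circle × SU11 => ‖matrixCoeff k (fun w => w ^ m) (fun w => w ^ n) q.2‖ := by
      ext q
      exact norm_matrixCoeffU_mulHom' k _ _ q.1 q.2
    rw [e]
    exact (integrable_matrixCoeff_monomial_monomial_of_three_le (nu haarCircle) k hk m n).norm.comp_snd
      haarCircle
  rw [hmap] at hint'
  exact (integrable_smul_measure (ENNReal.coe_ne_zero.mpr hc0) ENNReal.coe_ne_top).mp hint'

end Summit.Ventures.HodgeRepro2.T5BergmanIntegrableKFinite
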